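import Literature.NumberTheory.GaloisRepresentations.AlgebraicHeckeCharacterGrossencharakterProofs
import HarnessLib

/-!
# Weil 1956: the values of an algebraic Hecke character lie in a number field (proved)

Topic `NumberTheory/GaloisRepresentations`; namespace
`Literature.NumberTheory.GaloisRepresentations`.  Proofs-only companion (theorems, no definition,
no named fact, no instance; D-0026) of `AlgebraicHeckeCharacterGrossencharakterProofs` (the
Größencharakter `χ̃(𝔞) = ∏_𝔭 χ(ϖ_𝔭)^{v_𝔭(𝔞)}` of an algebraic Hecke character on the ray modulo a
module of definition, `HasInfinityType.idealPow_span_eq`) and of `LFunctions/RayClasses` (finiteness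
of the narrow ray classes, `finite_rayClassQuotient`).  It is the **complex** counterpart of §8 of
`WeilLAdicCharacterProofs` (there: all `ℓ`-adic values `ι⁻¹χ̃(𝔞)` lie in a finite extension of `ℚ_ℓ`,
where finiteness is free because `ℚ̄_ℓ/ℚ_ℓ` is algebraic; here the algebraicity over `ℚ` is the
point and has to be proved).

**The result (Weil).**  A. Weil, *On a certain type of characters of the idèle-class group of an
algebraic number-field* (Tokyo–Nikko 1955), §1: a Hecke character `χ` of type `A₀` of the number
field `K`, with module of definition `𝔪`, induces a character `χ̃` of the group `I^𝔪` of ideals prime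
to `𝔪` whose values are algebraic numbers, all lying in one finite extension of `ℚ`.  Restated (for
type `A`, values algebraic) in S. Patrikis, *Variations on a theorem of Tate*, Mem. AMS 1238 (2019)
= arXiv:1207.6724, **Lemma 2.1.2 (Weil)** (held text `paper:arxiv-1207.6724`, p. 18: "Let `χ` be a
type `A` Hecke character locally trivialized by the modulus `𝔪`.  `χ` then induces a character `χ^𝔪`
of `I^𝔪`, the group of non-zero, prime to `𝔪`, fractional ideals, whose values are all algebraic
numbers.").  This is the case `n = 1` of Clozel's theorem that the Hecke eigenvalues of a regular
algebraic cuspidal automorphic representation of `GL_n` lie in a number field (Clozel 1990,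
Thm. 3.13), used as such in `Automorphic/ClozelCArithmeticProofs`.

**The proof formalised** (Weil's, as in every account, e.g. Serre, *Abelian ℓ-adic
representations*, Ch. II §2.4–2.5): fix an infinity type `(p, q)` and a module of definition
`(T, e)`, `𝔪 = ∏_{v ∈ T} 𝔭_v^{e_v+1}`.
* `exists_pos_rayClassRel_top_pow` — for `𝔞` integral prime to `𝔪`, some power `𝔞^m`, `m ≥ 1`,
  lies in the trivial narrow ray class `mod 𝔪` (pigeonhole on `k ↦ [𝔞^k]` in the finite set of
  classes, then cancellation of `𝔞^i` in the Dedekind domain `𝓞_K`);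
* `HasInfinityType.isIntegral_idealPow` — hence `χ̃(𝔞)^m = χ̃((b))/χ̃((c)) =
  ∏_w σ_w(b/c)^{p_w} \overline{σ_w(b/c)}^{q_w}` (`idealPow_span_eq`) lies in any subfield
  containing all conjugates of `K`, e.g. the number field generated by them, so `χ̃(𝔞)` is an
  algebraic number (a root of `X^m − χ̃(𝔞)^m`);
* `HasInfinityType.exists_intermediateField_idealPow_mem` — the field `E` generated over `ℚ` by
  the conjugates of a primitive element of `K` and by the values `χ̃(𝔞_i)` at representatives of the
  finitely many narrow ray classes `mod 𝔪` is a number field containing every `χ̃(𝔞)`, `𝔞` prime to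
  `𝔪` (`χ̃(𝔞) = χ̃(𝔞_i) · (∏_w σ_w(b/c)^{p_w} ⋯)⁻¹` for `𝔞` in the class of `𝔞_i`);
* `IsAlgebraic.exists_intermediateField_valueAtUniformizer_mem` — **Weil's theorem in the form
  used for automorphic representations of `GL₁`**: for an algebraic Hecke character `χ` there is a
  number field `E ⊂ ℂ` (an `IntermediateField ℚ ℂ`, finite-dimensional over `ℚ`, containing every
  conjugate of `K`) with `χ(ϖ_v) ∈ E` at every finite place `v` where `χ` is unramified (take for
  `(T, e)` a module of definition supported on the ramified places, `exists_isModulus_of_ramified`).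

Nothing here is specific to CM fields; no statement about which number field `E` is (Weil: the
field generated by the values is of type CM or totally real — not needed, not proved).

## References

* A. Weil, *On a certain type of characters of the idèle-class group of an algebraic number-field*,
  Proc. Int. Symp. Tokyo–Nikko 1955 (1956), 1–7, §1. [Weil1956]
* S. Patrikis, *Variations on a theorem of Tate*, Mem. Amer. Math. Soc. 258 (2019), no. 1238 =
  arXiv:1207.6724, Lemma 2.1.2. [Patrikis2019]
* J. Neukirch, *Algebraic Number Theory* (1999), Ch. VI §1 (1.7)–(1.9), Ch. VII §6 (6.13)–(6.14).
  [NeukirchANT1999]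
-/

noncomputable section

open scoped NumberField ComplexConjugate Classical IntermediateField
open NumberField IsDedekindDomain Filter

namespace Literature.NumberTheory.GaloisRepresentations

universe u

variable {K : Type u} [Field K] [NumberField K]

namespace HeckeCharacter

/-! ### §1. A power of an ideal prime to `𝔪` lies in the trivial narrow ray class -/

/-- **Some power of an ideal prime to `𝔪` is trivial in the narrow ray class group `mod 𝔪`**: for a
nonzero integral ideal `𝔞` prime to `𝔪 ≠ 0` there is `m ≥ 1` with `𝔞^m` in the narrow ray class of
`(1)`, i.e. `(c) 𝔞^m = (b)` with `b ≡ c mod 𝔪`, `c` prime to `𝔪`, `b/c` totally positive.  (The classes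
of the powers `𝔞^k` range over the finite set of classes, `LFunctions.finite_rayClassQuotient`, so two
of them agree, and `𝔞^i` cancels in the monoid of ideals of the Dedekind domain `𝓞_K`.)
Ref: Neukirch, *Algebraic Number Theory*, Ch. VI §1, Prop. (1.8) (finiteness of `J^𝔪/P^𝔪`).
[cite: NeukirchANT1999, Ch. VI §1 Prop. (1.8)] -/
theorem exists_pos_rayClassRel_top_pow {𝔪 𝔞 : Ideal (𝓞 K)} (h𝔪 : 𝔪 ≠ ⊥) (h0 : 𝔞 ≠ ⊥)
    (hcop : IsCoprime 𝔞 𝔪) : ∃ m : ℕ, 0 < m ∧ LFunctions.RayClassRel 𝔪 ⊤ (𝔞 ^ m) := by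
  haveI := LFunctions.finite_rayClassQuotient h𝔪
  let f : ℕ → Quotient (LFunctions.rayClassSetoid 𝔪) := fun k =>
    Quotient.mk _ ⟨𝔞 ^ k, pow_ne_zero k h0, hcop.pow_left⟩
  obtain ⟨i, j, hij, hfij⟩ := Finite.exists_ne_map_eq_of_infinite f
  wlog hlt : i < j generalizing i j
  · exact this j i hij.symm hfij.symm (lt_of_le_of_ne (not_lt.mp hlt) hij.symm)
  have hr : LFunctions.RayClassRel 𝔪 (𝔞 ^ j) (𝔞 ^ i) := Quotient.exact hfij
  obtain ⟨b, c, hb, hc, hcop', hbc, hpos, heq⟩ := hr.symm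
  -- `heq : (c) 𝔞^j = (b) 𝔞^i`
  refine ⟨j - i, Nat.sub_pos_of_lt hlt, b, c, hb, hc, hcop', hbc, hpos, ?_⟩
  rw [Ideal.mul_top]
  apply mul_right_cancel₀ (pow_ne_zero i h0)
  rw [mul_assoc, ← pow_add, Nat.sub_add_cancel hlt.le, heq]

/-! ### §2. Conjugates of `K` inside a subfield of `ℂ` -/

/-- If a subfield `F ⊆ ℂ` (over `ℚ`) contains the image of a primitive element `θ` of `K/ℚ` under an
embedding `f : K → ℂ`, it contains `f(K)` (`f(K) = ℚ(f θ)`). [folklore] -/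
theorem algHom_apply_mem_of_adjoin_simple_eq_top {θ : K} (hθ : ℚ⟮θ⟯ = ⊤)
    {F : IntermediateField ℚ ℂ} (f : K →ₐ[ℚ] ℂ) (hf : f θ ∈ F) (x : K) : f x ∈ F := by
  have h1 : f.fieldRange = ℚ⟮f θ⟯ := by
    rw [AlgHom.fieldRange_eq_map, ← hθ, IntermediateField.adjoin_map, Set.image_singleton]
  have h2 : f.fieldRange ≤ F := by
    rw [h1]
    exact IntermediateField.adjoin_simple_le_iff.mpr hf
  exact h2 (f.mem_fieldRange.mpr ⟨x, rfl⟩)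

/-- The archimedean ratio `∏_w σ_w(y)^{p_w} \overline{σ_w(y)}^{q_w}` of an element `y ∈ K` lies in
any subfield of `ℂ` containing all conjugates of `K` (`\overline{σ_w}` is again an embedding). [folklore] -/
theorem archRatio_mem {F : IntermediateField ℚ ℂ} (hF : ∀ (φ : K →+* ℂ) (x : K), φ x ∈ F)
    (p q : InfinitePlace K → ℤ) (y : K) :
    (∏ w : InfinitePlace K, w.embedding y ^ (p w) * conj (w.embedding y) ^ (q w)) ∈ F := by
  refine prod_mem fun w _ => mul_mem (zpow_mem (hF _ _) _) (zpow_mem ?_ _)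
  rw [← NumberField.ComplexEmbedding.conjugate_coe_eq]
  exact hF _ _

/-! ### §3. The values of the Größencharakter are algebraic (Weil; Patrikis Lemma 2.1.2) -/

section Modulus

variable {χ : HeckeCharacter K} {p q : InfinitePlace K → ℤ}
  {T : Finset (HeightOneSpectrum (𝓞 K))} {e : HeightOneSpectrum (𝓞 K) → ℕ}

/-- **On the trivial ray class the Größencharakter is an archimedean ratio**: if `(c) 𝔞^m = (b)`
with `b ≡ c mod 𝔪`, `c` prime to `𝔪 = 𝔪(T, e)` and `b/c` totally positive, then
`χ̃(𝔞)^m = ∏_w σ_w(b/c)^{p_w} \overline{σ_w(b/c)}^{q_w}` (`HasInfinityType.idealPow_span_eq`: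
`χ̃((b)) = χ̃((c)) · ∏_w ⋯`, and `χ̃((c)) ≠ 0`).  Ref: Weil 1956 §1; Neukirch VII (6.13)–(6.14).
[cite: Weil1956, §1] [cite: NeukirchANT1999, Ch. VII §6 Prop. (6.13) and Cor. (6.14)] -/
theorem HasInfinityType.idealPow_pow_eq_archRatio (hinf : χ.HasInfinityType p q) (hmod : IsModulus χ T e)
    {𝔞 : Ideal (𝓞 K)} (h0 : 𝔞 ≠ ⊥) {m : ℕ} {b c : 𝓞 K} (hb : b ≠ 0) (hc : c ≠ 0)
    (hcop : IsCoprime (Ideal.span {c}) (modulusIdeal T e)) (hbc : b - c ∈ modulusIdeal T e)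
    (hpos : ∀ φ : K →+* ℝ, 0 < φ b * φ c) (heq : Ideal.span {c} * 𝔞 ^ m = Ideal.span {b} * ⊤) :
    LFunctions.idealPow K (fun v => χ.valueAtUniformizer v) 𝔞 ^ m =
      ∏ w : InfinitePlace K, w.embedding ((b : K) / c) ^ (p w) * conj (w.embedding ((b : K) / c)) ^ (q w) := by
  have hb0 : (Ideal.span {b} : Ideal (𝓞 K)) ≠ ⊥ := by rwa [Ne, Ideal.span_singleton_eq_bot]
  have hc0 : (Ideal.span {c} : Ideal (𝓞 K)) ≠ ⊥ := by rwa [Ne, Ideal.span_singleton_eq_bot]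
  have h1 := congrArg (LFunctions.idealPow K (fun v => χ.valueAtUniformizer v)) heq
  rw [Ideal.mul_top, LFunctions.idealPow_mul _ hc0 (pow_ne_zero m h0), LFunctions.idealPow_pow _ h0,
    hinf.idealPow_span_eq hmod hb hc hcop hbc hpos] at h1
  exact mul_left_cancel₀ (idealPow_ne_zero (valueAtUniformizer_ne_zero' χ) _) h1

/-- **The values of the Größencharakter of an algebraic Hecke character are algebraic numbers**
(Weil 1956, §1; Patrikis 2019, Lemma 2.1.2: "`χ` then induces a character `χ^𝔪` of `I^𝔪` … whose
values are all algebraic numbers"), for integral `𝔞` prime to the module of definition: with `m ≥ 1`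
as in `exists_pos_rayClassRel_top_pow`, `χ̃(𝔞)^m` is an archimedean ratio
(`idealPow_pow_eq_archRatio`), which lies in the number field generated by the conjugates of `K`
(hypotheses `hfd`, `hF`: any subfield of `ℂ` finite over `ℚ` containing them), hence is integral over
`ℚ`; so is its `m`-th root `χ̃(𝔞)` (`IsIntegral.of_pow`).
[cite: Patrikis2019, Lemma 2.1.2 (arXiv:1207.6724 §2.1)] [cite: Weil1956, §1] -/
theorem HasInfinityType.isIntegral_idealPow (hinf : χ.HasInfinityType p q) (hmod : IsModulus χ T e)
    {F : IntermediateField ℚ ℂ} (hfd : FiniteDimensional ℚ F) (hF : ∀ (φ : K →+* ℂ) (x : K), φ x ∈ F)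
    {𝔞 : Ideal (𝓞 K)} (h0 : 𝔞 ≠ ⊥) (hcop : IsCoprime 𝔞 (modulusIdeal T e)) :
    IsIntegral ℚ (LFunctions.idealPow K (fun v => χ.valueAtUniformizer v) 𝔞) := by
  obtain ⟨m, hm, b, c, hb, hc, hcop', hbc, hpos, heq⟩ :=
    exists_pos_rayClassRel_top_pow (modulusIdeal_ne_bot T e) h0 hcop
  have key := hinf.idealPow_pow_eq_archRatio hmod h0 hb hc hcop' hbc hpos heq
  have hR := archRatio_mem hF p q ((b : K) / c)
  haveI := hfd
  have hint : IsIntegral ℚ (∏ w : InfinitePlace K,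
      w.embedding ((b : K) / c) ^ (p w) * conj (w.embedding ((b : K) / c)) ^ (q w)) :=
    IntermediateField.isIntegral_iff.mp (IsIntegral.of_finite ℚ (⟨_, hR⟩ : F))
  refine IsIntegral.of_pow hm ?_
  rw [key]
  exact hint

/-- **The values of the Größencharakter lie in one number field** (Weil 1956, §1): for `χ` of infinity
type `(p, q)` with module of definition `(T, e)`, `𝔪 = 𝔪(T, e)`, there is a subfield `E ⊆ ℂ` finite
over `ℚ`, containing all conjugates of `K`, such that `χ̃(𝔞) ∈ E` for every nonzero integral ideal `𝔞`
prime to `𝔪`.  `E` is generated over `ℚ` by the conjugates of a primitive element of `K` and the values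
`χ̃(𝔞_i)` at representatives `𝔞_i` of the finitely many narrow ray classes `mod 𝔪`
(`LFunctions.finite_rayClassQuotient`), all integral over `ℚ` (`isIntegral_idealPow`); for `𝔞` in the
class of `𝔞_i`, `(c) 𝔞_i = (b) 𝔞` gives `χ̃(𝔞) = χ̃(𝔞_i) · (∏_w σ_w(b/c)^{p_w} ⋯)⁻¹ ∈ E`
(`idealPow_span_eq`).  [cite: Weil1956, §1] [cite: Patrikis2019, Lemma 2.1.2 (arXiv:1207.6724 §2.1)] -/
theorem HasInfinityType.exists_intermediateField_idealPow_mem (hinf : χ.HasInfinityType p q)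
    (hmod : IsModulus χ T e) :
    ∃ E : IntermediateField ℚ ℂ, FiniteDimensional ℚ E ∧ (∀ (φ : K →+* ℂ) (x : K), φ x ∈ E) ∧
      ∀ 𝔞 : Ideal (𝓞 K), 𝔞 ≠ ⊥ → IsCoprime 𝔞 (modulusIdeal T e) →
        LFunctions.idealPow K (fun v => χ.valueAtUniformizer v) 𝔞 ∈ E := by
  set ψ : HeightOneSpectrum (𝓞 K) → ℂ := fun v => χ.valueAtUniformizer v with hψ
  set 𝔪 : Ideal (𝓞 K) := modulusIdeal T e with h𝔪def
  have h𝔪 : 𝔪 ≠ ⊥ := modulusIdeal_ne_bot T e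
  haveI := LFunctions.finite_rayClassQuotient h𝔪
  obtain ⟨θ, hθ⟩ := Field.exists_primitive_element ℚ K
  have hθint : ∀ φ : K →+* ℂ, IsIntegral ℚ (φ θ) := fun φ =>
    (IsIntegral.of_finite ℚ θ).map φ.toRatAlgHom
  -- the number field generated by the conjugates of `K`
  set S₀ : Set ℂ := Set.range fun φ : K →+* ℂ => φ θ with hS₀
  haveI : Finite S₀ := (Set.finite_range _).to_subtype
  set F : IntermediateField ℚ ℂ := IntermediateField.adjoin ℚ S₀ with hFdef
  have hFfd : FiniteDimensional ℚ F :=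
    IntermediateField.finiteDimensional_adjoin fun x hx => by
      obtain ⟨φ, rfl⟩ := hx
      exact hθint φ
  have hF : ∀ (φ : K →+* ℂ) (x : K), φ x ∈ F := fun φ x => by
    have hmem : (φ θ : ℂ) ∈ F := IntermediateField.subset_adjoin ℚ S₀ ⟨φ, rfl⟩
    exact algHom_apply_mem_of_adjoin_simple_eq_top hθ φ.toRatAlgHom hmem x
  -- add the values at representatives of the narrow ray classes
  set S : Set ℂ := S₀ ∪ Set.range fun cl : Quotient (LFunctions.rayClassSetoid 𝔪) =>
    LFunctions.idealPow K ψ cl.out.1 with hS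
  haveI : Finite S := ((Set.finite_range _).union (Set.finite_range _)).to_subtype
  set E : IntermediateField ℚ ℂ := IntermediateField.adjoin ℚ S with hEdef
  have hFE : F ≤ E := IntermediateField.adjoin.mono ℚ _ _ Set.subset_union_left
  have hEfd : FiniteDimensional ℚ E := by
    refine IntermediateField.finiteDimensional_adjoin fun x hx => ?_
    rcases hx with ⟨φ, rfl⟩ | ⟨cl, rfl⟩
    · exact hθint φ
    · exact hinf.isIntegral_idealPow hmod hFfd hF cl.out.2.1 cl.out.2.2
  have hE : ∀ (φ : K →+* ℂ) (x : K), φ x ∈ E := fun φ x => hFE (hF φ x)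
  refine ⟨E, hEfd, hE, fun 𝔞 h0 hcop => ?_⟩
  -- `𝔞` versus the representative of its class
  set 𝔞₀ : LFunctions.CoprimeIdeal 𝔪 := ⟨𝔞, h0, hcop⟩ with h𝔞₀
  set cl : Quotient (LFunctions.rayClassSetoid 𝔪) := Quotient.mk _ 𝔞₀ with hcl
  have hrel : LFunctions.RayClassRel 𝔪 𝔞₀.1 cl.out.1 :=
    (LFunctions.rayClassSetoid_r_iff cl.out 𝔞₀).mp (Quotient.mk_out 𝔞₀)
  obtain ⟨b, c, hb, hc, hcop', hbc, hpos, heq⟩ := hrel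
  -- `heq : (c) 𝔞_i = (b) 𝔞`
  have hb0 : (Ideal.span {b} : Ideal (𝓞 K)) ≠ ⊥ := by rwa [Ne, Ideal.span_singleton_eq_bot]
  have hc0 : (Ideal.span {c} : Ideal (𝓞 K)) ≠ ⊥ := by rwa [Ne, Ideal.span_singleton_eq_bot]
  set R : ℂ := ∏ w : InfinitePlace K, w.embedding ((b : K) / c) ^ (p w) *
    conj (w.embedding ((b : K) / c)) ^ (q w) with hR
  have h1 := congrArg (LFunctions.idealPow K ψ) heq
  rw [LFunctions.idealPow_mul ψ hc0 cl.out.2.1, LFunctions.idealPow_mul ψ hb0 h0,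
    hinf.idealPow_span_eq hmod hb hc hcop' hbc hpos, mul_assoc] at h1
  -- `h1 : χ̃((c)) χ̃(𝔞_i) = χ̃((c)) (R χ̃(𝔞))`
  have h2 : LFunctions.idealPow K ψ cl.out.1 = R * LFunctions.idealPow K ψ 𝔞 :=
    mul_left_cancel₀ (idealPow_ne_zero (valueAtUniformizer_ne_zero' χ) _) h1
  have hRne : R ≠ 0 := by
    intro hR0
    rw [hR0, zero_mul] at h2
    exact idealPow_ne_zero (valueAtUniformizer_ne_zero' χ) _ h2
  have h3 : LFunctions.idealPow K ψ 𝔞 = LFunctions.idealPow K ψ cl.out.1 * R⁻¹ := by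
    rw [h2, mul_comm R, mul_assoc, mul_inv_cancel₀ hRne, mul_one]
  rw [h3]
  exact mul_mem (IntermediateField.subset_adjoin ℚ S (Or.inr ⟨cl, rfl⟩))
    (inv_mem (archRatio_mem hE p q _))

end Modulus

/-! ### §4. Weil's theorem at the unramified places -/

/-- A maximal ideal not containing `𝔪` is prime to it (as `HeightOneSpectrum.isCoprime_of_not_le` of
`WeilLAdicCharacterProofs`, universe-polymorphic copy kept private). [folklore] -/
private theorem isCoprime_asIdeal_of_not_le {𝔪 : Ideal (𝓞 K)} (v : HeightOneSpectrum (𝓞 K))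
    (hv : ¬ 𝔪 ≤ v.asIdeal) : IsCoprime v.asIdeal 𝔪 := by
  rw [Ideal.isCoprime_iff_sup_eq]
  by_contra hne
  exact hv (le_sup_right.trans (v.isMaximal.eq_of_le hne le_sup_left).ge)

/-- **Weil's theorem (values of an algebraic Hecke character).**  For an algebraic Hecke character
`χ` (type `A₀`, `HeckeCharacter.IsAlgebraic`) of a number field `K` there is a subfield `E ⊆ ℂ`,
finite over `ℚ` and containing every conjugate of `K`, such that `χ(ϖ_v) ∈ E` at every finite place
`v` where `χ` is unramified.  (Take a module of definition `(T, e)` supported on the ramified places,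
`exists_isModulus_of_ramified`; an unramified `v` is prime to `𝔪(T, e)` and `χ(ϖ_v) = χ̃(𝔭_v)`,
`LFunctions.idealPow_asIdeal`; apply `exists_intermediateField_idealPow_mem`.)  Weil 1956, §1;
Patrikis 2019, Lemma 2.1.2 (values algebraic); the case `n = 1` of Clozel 1990, Thm. 3.13.
[cite: Weil1956, §1] [cite: Patrikis2019, Lemma 2.1.2 (arXiv:1207.6724 §2.1)] -/
theorem IsAlgebraic.exists_intermediateField_valueAtUniformizer_mem {χ : HeckeCharacter K}
    (hχ : χ.IsAlgebraic) :
    ∃ E : IntermediateField ℚ ℂ, FiniteDimensional ℚ E ∧ (∀ (φ : K →+* ℂ) (x : K), φ x ∈ E) ∧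
      ∀ v : HeightOneSpectrum (𝓞 K), χ.IsUnramifiedAt v → χ.valueAtUniformizer v ∈ E := by
  obtain ⟨p, q, hinf⟩ := (χ.isAlgebraic_iff_exists_hasInfinityType).mp hχ
  obtain ⟨e, hmod⟩ := χ.exists_isModulus_of_ramified
  obtain ⟨E, hfd, hemb, hval⟩ := hinf.exists_intermediateField_idealPow_mem hmod
  refine ⟨E, hfd, hemb, fun v hv => ?_⟩
  have hvT : v ∉ (finite_ramifiedPlaces_holds χ).toFinset := fun h =>
    ((finite_ramifiedPlaces_holds χ).mem_toFinset.mp h) hv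
  have hcop : IsCoprime v.asIdeal (modulusIdeal (finite_ramifiedPlaces_holds χ).toFinset e) :=
    isCoprime_asIdeal_of_not_le v fun h => hvT (modulusIdeal_le_iff.mp h)
  have := hval v.asIdeal v.ne_bot hcop
  rwa [LFunctions.idealPow_asIdeal] at this

/-- **Weil's theorem, cofinite form**: the values `χ(ϖ_v)` of an algebraic Hecke character at all but
finitely many finite places lie in one number field `E ⊆ ℂ` (the ramified places are finitely many,
`finite_ramifiedPlaces_holds`). [cite: Weil1956, §1] -/
theorem IsAlgebraic.exists_intermediateField_eventually_valueAtUniformizer_mem {χ : HeckeCharacter K}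
    (hχ : χ.IsAlgebraic) :
    ∃ E : IntermediateField ℚ ℂ, FiniteDimensional ℚ E ∧
      ∀ᶠ v : HeightOneSpectrum (𝓞 K) in cofinite, χ.valueAtUniformizer v ∈ E := by
  obtain ⟨E, hfd, -, hval⟩ := hχ.exists_intermediateField_valueAtUniformizer_mem
  refine ⟨E, hfd, ?_⟩
  have hcof : ∀ᶠ v : HeightOneSpectrum (𝓞 K) in cofinite, χ.IsUnramifiedAt v :=
    (χ.finite_ramifiedPlaces_iff).mp (finite_ramifiedPlaces_holds χ)
  exact hcof.mono hval

end HeckeCharacter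

end Literature.NumberTheory.GaloisRepresentations
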